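import Summits.ValiantsHypothesis.ValiantsHypothesis.Theorems.KPlusLogSqLawTropicalGradedWalkPotD
import Summits.ValiantsHypothesis.ValiantsHypothesis.Theorems.KPlusLogSqLawTropicalShiftSquare
import Summits.ValiantsHypothesis.ValiantsHypothesis.Theorems.KPlusLogSqLawTropicalGradedWalkDomD1
import Summits.ValiantsHypothesis.ValiantsHypothesis.Theorems.KPlusLogSqLawTropicalGradedWalkDomD2
import Summits.ValiantsHypothesis.ValiantsHypothesis.Theorems.KPlusLogSqLawTropicalGradedWalkDomD3
import Summits.ValiantsHypothesis.ValiantsHypothesis.Theorems.KPlusLogSqLawTropicalGradedWalkDomD4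
import Summits.ValiantsHypothesis.ValiantsHypothesis.Theorems.KPlusLogSqLawTropicalGradedWalkDomD5
import Summits.ValiantsHypothesis.ValiantsHypothesis.Theorems.KPlusLogSqLawTropicalGradedWalkDomD6
import Summits.ValiantsHypothesis.ValiantsHypothesis.Theorems.KPlusLogSqLawTropicalGradedWalkDomD7
import Summits.ValiantsHypothesis.ValiantsHypothesis.Theorems.KPlusLogSqLawTropicalGradedWalkDomD8
import Summits.ValiantsHypothesis.ValiantsHypothesis.Theorems.KPlusLogSqLawTropicalGradedWalkDomD9
import Summits.ValiantsHypothesis.ValiantsHypothesis.Theorems.KPlusLogSqLawTropicalGradedWalkDomD10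
import Summits.ValiantsHypothesis.ValiantsHypothesis.Theorems.KPlusLogSqLawTropicalGradedWalkDomD11
import Summits.ValiantsHypothesis.ValiantsHypothesis.Theorems.KPlusLogSqLawTropicalGradedWalkDomD12
import Summits.ValiantsHypothesis.ValiantsHypothesis.Theorems.KPlusLogSqLawTropicalGradedWalkDomD13

/-!
# Dominance glue (type D), part 1: interface lemmas; rivals at or below the intended cell

GRW-lite `K = 4` graded-walk family (census side of the tropical root law, all `m`):
dominance glue for the diagonal states `(w, u, 0)`, `u < w < m`, of the design typed in
`KPlusLogSqLawTropicalGradedWalkDefs`.  The slack of every rival cell against the column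
potential `UD` (file `…PotD`) was certified family by family in `…DomD1` – `…DomD13`; the files
`…DomDGlue1` – `…DomDGlue5` dispatch an arbitrary rival `(a, b, l)` to its family and conclude
`IsDominant` for these states via `isDominant_of_scaledPotential`.

Honest framing: this is a census-side (lower-bound) construction — a quadratic family of
distinct optimal slopes for `TropRootLawAt (n+1) 4`.  It says nothing about `TropicalB` inside
its window and nothing about VP ≠ VNP.
-/

set_option linter.dupNamespace false
set_option autoImplicit false

namespace Summit.ValiantsHypothesis.ValiantsHypothesis.Theorems.LacunarySymmetroidMatrixDescartes.TropicalCensus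

namespace GradedWalk

open Summit.ValiantsHypothesis.ValiantsHypothesis.Theorems.MatrixDescartes.Negative

variable (n : ℕ)

/-! ### interface lemmas for the dominance glue (type D) -/

/-- the phase rotation is SHIFT-SQUARE's rotation by `m − w`. -/
theorem rot_eq_shiftSquare (w : ℕ) : rot n w = ShiftSquare.rot n (n + 1 - w) := rfl

/-- value of the rotation on a block column. -/
theorem rot_val_blk {w : ℕ} (hw : w ≤ n + 1) (b : Fin (n + 1)) (hb : (b : ℕ) < w) :
    ((rot n w b : Fin (n + 1)) : ℕ) = (b : ℕ) + (n + 1 - w) := by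
  rw [rot_eq_shiftSquare, ShiftSquare.rot_val n (n + 1 - w) (by omega) b]
  split_ifs with h
  · omega
  · rfl

/-- value of the rotation on a wrap column. -/
theorem rot_val_wrap {w : ℕ} (hw : w ≤ n + 1) (b : Fin (n + 1)) (hb : w ≤ (b : ℕ)) :
    ((rot n w b : Fin (n + 1)) : ℕ) = (b : ℕ) - w := by
  rw [rot_eq_shiftSquare, ShiftSquare.rot_val n (n + 1 - w) (by omega) b]
  have := b.isLt
  split_ifs with h
  · omega
  · omega

/-- the diagonal states use the plain rotation. -/
theorem perm_D {w u : ℕ} (h : u ≠ w) : perm n w u 0 = rot n w := by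
  unfold perm; rw [if_neg h]; simp [cyc]

/-- class map of the diagonal state `(w, u, 0)`, `u < w`. -/
theorem lam_D {w u : ℕ} (hu : u < w) (b : Fin (n + 1)) :
    lam n w u 0 b = if w ≤ (b : ℕ) then 0 else if (b : ℕ) < u then 2 else 1 := by
  unfold lam
  rw [if_neg (Nat.ne_of_lt hu)]
  simp only [add_zero]
  by_cases h1 : w ≤ (b : ℕ)
  · rw [if_pos h1, if_pos h1]
  · rw [if_neg h1, if_neg h1]
    by_cases h2 : (b : ℕ) < u
    · rw [if_pos h2, if_pos h2]
    · rw [if_neg h2, if_neg h2, if_neg h2]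

/-- class-`1` valuation. -/
theorem vblk_one (E b : ℕ) : vblk n E b 1 = v1 n E b := by simp [vblk]
/-- class-`2` valuation. -/
theorem vblk_two (E b : ℕ) : vblk n E b 2 = v1 n E b + bB n * tau2 n E b := by simp [vblk]
/-- class-`3` valuation. -/
theorem vblk_three (E b : ℕ) : vblk n E b 3 = v1 n E b + bB n * tau2 n E b + tau3 n E b := by simp [vblk]

/-- valuation of a lower cell. -/
theorem vv_lower {a b : Fin (n + 1)} (h : (b : ℕ) < (a : ℕ)) (l : Fin 4) :
    vv n a b l = vblk n (n + 1 + (b : ℕ) - (a : ℕ)) b l := by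
  unfold vv; rw [if_pos h]

/-- valuation of a diagonal cell, class `≥ 1`. -/
theorem vv_diag {a b : Fin (n + 1)} (h : (a : ℕ) = (b : ℕ)) (l : Fin 4) (hl : (l : ℕ) ≠ 0) :
    vv n a b l = vblk n (n + 1) b l := by
  unfold vv; rw [if_neg (by omega), if_pos h, if_neg hl]

/-- valuation of a diagonal cell, class `0`. -/
theorem vv_diag_zero {a b : Fin (n + 1)} (h : (a : ℕ) = (b : ℕ)) : vv n a b 0 = 0 := by
  unfold vv; rw [if_neg (by omega), if_pos h]; rfl

/-- valuation of an upper cell, class `0`. -/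
theorem vv_upper_zero {a b : Fin (n + 1)} (h : (a : ℕ) < (b : ℕ)) :
    vv n a b 0 = 4 * mZ n * gG n ^ 2 * (((b : ℕ) : ℤ) - ((a : ℕ) : ℤ)) ^ 2 := by
  unfold vv; rw [if_neg (by omega), if_neg (by omega)]; rfl

/-- valuation of an upper cell, class `1` (connector). -/
theorem vv_upper_one {a b : Fin (n + 1)} (h : (a : ℕ) < (b : ℕ)) :
    vv n a b 1 = conn n ((b : ℕ) - (a : ℕ)) b := by
  unfold vv; rw [if_neg (by omega), if_neg (by omega)]; rfl

/-- a lower cell carries no class `0`. -/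
theorem ee_lower_zero {a b : Fin (n + 1)} (h : (b : ℕ) < (a : ℕ)) : ee n a b 0 = 0 := by
  unfold ee; rw [if_pos h]; rfl

/-- an upper cell carries no class `≥ 2`. -/
theorem ee_upper_ge_two {a b : Fin (n + 1)} (h : (a : ℕ) < (b : ℕ)) (l : Fin 4) (hl : 2 ≤ (l : ℕ)) : ee n a b l = 0 := by
  unfold ee; rw [if_neg (by omega), if_neg (by omega), if_neg (by omega), if_neg (by omega)]

/-- a lower cell with class `≥ 1` is present. -/
theorem ee_lower_ne {a b : Fin (n + 1)} (h : (b : ℕ) < (a : ℕ)) (l : Fin 4) (hl : (l : ℕ) ≠ 0) : ee n a b l ≠ 0 := by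
  unfold ee; rw [if_pos h, if_neg hl]
  split_ifs <;>
  · intro h0
    have h0' := congrArg Int.natAbs h0
    simp at h0'

/-- an upper cell with class `0` is present. -/
theorem ee_upper_zero_ne {a b : Fin (n + 1)} (h : (a : ℕ) < (b : ℕ)) : ee n a b 0 ≠ 0 := by
  unfold ee; rw [if_neg (by omega), if_neg (by omega)]
  simp only [Fin.val_zero, ↓reduceIte]
  unfold zsign
  split_ifs
  · exact pow_ne_zero _ (by norm_num)
  · norm_num

/-- bend below the walked column. -/
theorem muD_lt {w u j : ℕ} (h : j < u) : muD n w u j = SUB2 n w u j := by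
  unfold muD; rw [if_pos h]
/-- bend at and beyond the walked column (`u ≥ 1`). -/
theorem muD_ge {w u j : ℕ} (hu : u ≠ 0) (h : ¬ j < u) : muD n w u j = SUBu n w u + SLB n w u j := by
  unfold muD; rw [if_neg h, if_neg hu]
/-- bend for `u = 0`. -/
theorem muD_z (w j : ℕ) : muD n w 0 j = SLB0 n w j := by
  unfold muD; simp
/-- the bend increment vanishes at `j = u`. -/
theorem SLB_self (w u : ℕ) : SLB n w u u = 0 := by
  unfold SLB; ring

/-- packaging of a slack inequality (no potential difference). -/
theorem slack_of0 {X X' Y Z T T' : ℤ} (hF : X' + 1 ≤ T') (hX : X = X') (hT : T = T') (hY : Y - Z = 0) :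
    1 * X < Y + (T - Z) := by
  subst hX; subst hT; linarith

/-- packaging of a slack inequality. -/
theorem slack_of {X X' Y Z D T T' : ℤ} (hF : X' + 1 ≤ D + T') (hX : X = X') (hT : T = T') (hY : Y - Z = D) :
    1 * X < Y + (T - Z) := by
  subst hX; subst hT; linarith

/-- packaging of a slack inequality with a class lift. -/
theorem slack_le {X X1 Y Z D T T' : ℤ} (hF : X1 + 1 ≤ D + T') (hXl : X ≤ X1) (hT : T = T') (hY : Y - Z = D) :
    1 * X < Y + (T - Z) := by
  subst hT; linarith

/-! ### slack, block column, rival at or below the intended cell -/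

set_option maxHeartbeats 400000 in
/-- slack of the type-D certificate: block column `b < w`, rival row `a ≥ r_b` (class rivals and the levels below). -/
theorem slackD_blk_ge (w u : ℕ) (huw : u < w) (hwn : w ≤ n) (a b : Fin (n + 1)) (l : Fin 4)
    (hp : ee n a b l ≠ 0) (hne : rot n w b ≠ a ∨ lam n w u 0 b ≠ l)
    (hbw : (b : ℕ) < w) (hge : (b : ℕ) + (n + 1 - w) ≤ (a : ℕ)) :
    1 * (thD n w u * (dd n l : ℤ) - vv n a b l) <
      UD n w u a + ((thD n w u * (dd n (lam n w u 0 b) : ℤ) - vv n (rot n w b) b (lam n w u 0 b)) - UD n w u (rot n w b)) := by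
  have hw1 : w ≤ n + 1 := by omega
  have ha := a.isLt
  have hr := rot_val_blk n hw1 b hbw
  have hlowr : (b : ℕ) < ((rot n w b : Fin (n + 1)) : ℕ) := by rw [hr]; omega
  have hlow : (b : ℕ) < (a : ℕ) := by omega
  rw [lam_D n huw, if_neg (not_le.mpr hbw)] at hne ⊢
  -- the intended term and potential, in the family vocabulary
  have hEr : n + 1 + (b : ℕ) - ((b : ℕ) + (n + 1 - w)) = w := by omega
  have hwne : w ≠ n + 1 := by omega
  have hT2 : thD n w u * (dd n 2 : ℤ) - vv n (rot n w b) b 2 = thD n w u * d2 n - (v1 n w b + bB n * tau2lt n w b) := by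
    rw [dd_cast_two, vv_lower n hlowr, hr, hEr, vblk_two, tau2_of_ne n hwne]
  have hT1 : thD n w u * (dd n 1 : ℤ) - vv n (rot n w b) b 1 = thD n w u * d1 n - v1 n w b := by
    rw [dd_cast_one, vv_lower n hlowr, hr, hEr, vblk_one]
  have hUr : UD n w u ((rot n w b : Fin (n + 1)) : ℕ) = gG n * thD n w u * ((((b : ℕ) + (n + 1 - w)) : ℕ) : ℤ) + muD n w u b := by
    rw [hr]; unfold UD; rw [show (b : ℕ) + (n + 1 - w) - (n + 1 - w) = b by omega]
  -- class of the rival: 1, 2 or 3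
  have hl0 : l ≠ 0 := fun h0 => hp (by rw [h0]; exact ee_lower_zero n hlow)
  rcases Nat.eq_or_lt_of_le hge with haeq | hagt
  · -- class rival at the intended cell
    have ha' : ((rot n w b : Fin (n + 1)) : ℕ) = (a : ℕ) := by rw [hr, haeq]
    have hrot : rot n w b = a := Fin.ext ha'
    have hY : UD n w u a - UD n w u ((rot n w b : Fin (n + 1)) : ℕ) = 0 := by rw [hrot]; ring
    have hEa : n + 1 + (b : ℕ) - (a : ℕ) = w := by omega
    rcases (show l = 0 ∨ l = 1 ∨ l = 2 ∨ l = 3 by fin_cases l <;> simp) with rfl | rfl | rfl | rfl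
    · exact absurd rfl hl0
    · have hX : thD n w u * (dd n 1 : ℤ) - vv n a b 1 = thD n w u * d1 n - v1 n w b := by
        rw [dd_cast_one, vv_lower n hlow, hEa, vblk_one]
      by_cases hbu : (b : ℕ) < u
      · rw [if_pos hbu] at hne ⊢
        exact slack_of0 (D_cls_blt_l1 n w u b (by omega) (by omega) hwn) hX hT2 hY
      · rw [if_neg hbu] at hne
        exact absurd rfl (hne.resolve_left (fun h => h hrot))
    · have hX : thD n w u * (dd n 2 : ℤ) - vv n a b 2 = thD n w u * d2 n - (v1 n w b + bB n * tau2lt n w b) := by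
        rw [dd_cast_two, vv_lower n hlow, hEa, vblk_two, tau2_of_ne n hwne]
      by_cases hbu : (b : ℕ) < u
      · rw [if_pos hbu] at hne
        exact absurd rfl (hne.resolve_left (fun h => h hrot))
      · rw [if_neg hbu] at hne ⊢
        exact slack_of0 (D_cls_bge_l2 n w u b (by omega) (by omega) hwn) hX hT1 hY
    · have hX : thD n w u * (dd n 3 : ℤ) - vv n a b 3 = thD n w u * d3 n - ((v1 n w b + bB n * tau2lt n w b) + tau3lt n w b) := by
        rw [dd_cast_three, vv_lower n hlow, hEa, vblk_three, tau2_of_ne n hwne, tau3_of_ne n hwne]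
      by_cases hbu : (b : ℕ) < u
      · rw [if_pos hbu] at hne ⊢
        exact slack_of0 (D_cls_blt_l3 n w u b (by omega) (by omega) hwn) hX hT2 hY
      · rw [if_neg hbu] at hne ⊢
        exact slack_of0 (D_cls_bge_l3 n w u b (by omega) (by omega) hwn) hX hT1 hY
  · -- rival below the intended cell: level w - k
    obtain ⟨k, hk⟩ : ∃ k, (a : ℕ) = (b : ℕ) + (n + 1 - w) + k := ⟨(a : ℕ) - ((b : ℕ) + (n + 1 - w)), by omega⟩
    have hk1 : 1 ≤ k := by omega
    have hkw : (b : ℕ) + k + 1 ≤ w := by omega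
    have hEa : n + 1 + (b : ℕ) - (a : ℕ) = w - k := by omega
    have hne3 : w - k ≠ n + 1 := by omega
    -- reduce every class to class 3 (the best past class)
    have hX3 : thD n w u * (dd n 3 : ℤ) - vv n a b 3 = thD n w u * d3 n - ((v1 n (w - k) b + bB n * tau2lt n (w - k) b) + tau3lt n (w - k) b) := by
      rw [dd_cast_three, vv_lower n hlow, hEa, vblk_three, tau2_of_ne n hne3, tau3_of_ne n hne3]
    have hlift : thD n w u * (dd n l : ℤ) - vv n a b l + (if l = 3 then 0 else 1) ≤ thD n w u * d3 n - ((v1 n (w - k) b + bB n * tau2lt n (w - k) b) + tau3lt n (w - k) b) := by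
      rcases (show l = 0 ∨ l = 1 ∨ l = 2 ∨ l = 3 by fin_cases l <;> simp) with rfl | rfl | rfl | rfl
      · exact absurd rfl hl0
      · rw [dd_cast_one, vv_lower n hlow, hEa, vblk_one]
        simp only [show ((1 : Fin 4) = 3) = False by decide, ite_false]
        rcases Nat.lt_or_ge (w - k) (u + 1) with h1 | h1
        · exact D_past1_1 n w u b (w - k) (by omega) (by omega) (by omega) hwn
        · rcases Nat.lt_or_ge (b : ℕ) (u + 1) with h3 | h3
          · exact D_past1_3 n w u b (w - k) (by omega) (by omega) (by omega) hwn
          · exact D_past1_4 n w u b (w - k) (by omega) (by omega) (by omega) hwn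
      · rw [dd_cast_two, vv_lower n hlow, hEa, vblk_two, tau2_of_ne n hne3]
        simp only [show ((2 : Fin 4) = 3) = False by decide, ite_false]
        rcases Nat.lt_or_ge (w - k) (u + 1) with h2 | h2
        · exact D_past2_1 n w u b (w - k) (by omega) (by omega) (by omega) hwn
        · rcases Nat.lt_or_ge (b : ℕ) (u + 1) with h3 | h3
          · exact D_past2_3 n w u b (w - k) (by omega) (by omega) (by omega) hwn
          · exact D_past2_4 n w u b (w - k) (by omega) (by omega) (by omega) hwn
      · rw [hX3]; simp
    -- the six bend regimes
    have hj : (a : ℕ) - (n + 1 - w) = (b : ℕ) + k := by omega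
    by_cases hu0 : u = 0
    · subst hu0
      rw [if_neg (Nat.not_lt_zero _)] at hne ⊢
      have hY : UD n w 0 a - UD n w 0 ((rot n w b : Fin (n + 1)) : ℕ) = gG n * thD n w 0 * ((k : ℕ) : ℤ) + (SLB0 n w (b + k) - SLB0 n w b) := by
        rw [hUr, muD_z]; unfold UD; rw [hj, muD_z, hk]; push_cast [Nat.cast_sub hw1]; ring
      have hF := D_down_Z n w b k hk1 hkw hwn
      exact slack_of (by split_ifs at hlift <;> linarith) rfl hT1 hY
    · by_cases hbu : (b : ℕ) < u
      · rw [if_pos hbu] at hne ⊢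
        rcases Nat.lt_trichotomy ((b : ℕ) + k) u with hlt | heq | hgt
        · have hY : UD n w u a - UD n w u ((rot n w b : Fin (n + 1)) : ℕ) = gG n * thD n w u * ((k : ℕ) : ℤ) + (SUB2 n w u (b + k) - SUB2 n w u b) := by
            rw [hUr, muD_lt n hbu]; unfold UD; rw [hj, muD_lt n hlt, hk]; push_cast [Nat.cast_sub hw1]; ring
          have hF := D_down_A n w u b k hk1 (by omega) (by omega) hwn
          exact slack_of (by split_ifs at hlift <;> linarith) rfl hT2 hY
        · subst heq
          have hY : UD n w ((b : ℕ) + k) a - UD n w ((b : ℕ) + k) ((rot n w b : Fin (n + 1)) : ℕ) = gG n * thD n w ((b : ℕ) + k) * ((k : ℕ) : ℤ) + (SUBu n w ((b : ℕ) + k) - SUB2 n w ((b : ℕ) + k) b) := by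
            rw [hUr, muD_lt n hbu]; unfold UD; rw [hj, muD_ge n hu0 (lt_irrefl _), SLB_self, hk]; push_cast [Nat.cast_sub hw1]; ring
          have hF := D_down_Bq n w b k hk1 hkw hwn
          exact slack_of (by split_ifs at hlift <;> linarith) rfl hT2 hY
        · have hY : UD n w u a - UD n w u ((rot n w b : Fin (n + 1)) : ℕ) = gG n * thD n w u * ((k : ℕ) : ℤ) + ((SUBu n w u + SLB n w u (b + k)) - SUB2 n w u b) := by
            rw [hUr, muD_lt n hbu]; unfold UD; rw [hj, muD_ge n hu0 (by omega), hk]; push_cast [Nat.cast_sub hw1]; ring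
          have hF := D_down_C n w u b k (by omega) (by omega) hkw hwn
          exact slack_of (by split_ifs at hlift <;> linarith) rfl hT2 hY
      · rw [if_neg hbu] at hne ⊢
        rcases Nat.eq_or_lt_of_le (Nat.le_of_not_lt hbu) with hub | hub
        · -- b = u
          have hY : UD n w u a - UD n w u ((rot n w b : Fin (n + 1)) : ℕ) = gG n * thD n w u * ((k : ℕ) : ℤ) + ((SUBu n w u + SLB n w u (u + k)) - SUBu n w u) := by
            rw [hUr, ← hub, muD_ge n hu0 (lt_irrefl _), SLB_self]; unfold UD; rw [hj, ← hub, muD_ge n hu0 (by omega), hk, ← hub]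
            push_cast [Nat.cast_sub hw1]; ring
          have hF := D_down_Dq n w u k (by omega) hk1 (by omega) hwn
          rw [← hub] at hlift hT1
          exact slack_of (by split_ifs at hlift <;> linarith) rfl hT1 hY
        · have hY : UD n w u a - UD n w u ((rot n w b : Fin (n + 1)) : ℕ) = gG n * thD n w u * ((k : ℕ) : ℤ) + ((SUBu n w u + SLB n w u (b + k)) - (SUBu n w u + SLB n w u b)) := by
            rw [hUr, muD_ge n hu0 hbu]; unfold UD; rw [hj, muD_ge n hu0 (by omega), hk]; push_cast [Nat.cast_sub hw1]; ring
          have hF := D_down_Ee n w u b k (by omega) (by omega) hk1 hkw hwn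
          exact slack_of (by split_ifs at hlift <;> linarith) rfl hT1 hY

end GradedWalk

end Summit.ValiantsHypothesis.ValiantsHypothesis.Theorems.LacunarySymmetroidMatrixDescartes.TropicalCensus
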